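import Summits.ABC.IUTFork.Cor312SoundInput
import Summits.ABC.IUTFork.ForkLocalGlobalWitness
import HarnessLib

/-!
# The fork at [IUTchIII] Corollary 3.12 — soundness at ALL inputs versus at THE input of the link (skeleton XXVc)

Record-only file (D-0012) of the abc-iut cell (skeleton seat abc-iut-skel, gen 4; G1′ countersign roster); TAKES NO SIDE.
Team A's GAP decl of record `Cor312Vol.SoundAtInput P G` (abc-iut-c312-9, `Cor312SoundInput`, GAP-LEDGER row G-c312-9-1)
reads Step (xi-f) of the proof of [IUTchIII] Cor. 3.12 as soundness of the multiradial algorithm AT EVERY INPUT OBJECT `o`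
of `†𝒞^⊩_lgp`: `∀ o, negLogThetaAt P o ≠ ⊤ ∧ ↑(negLogQAt P (G.linkMap o)) ≤ negLogThetaAt P o`. This file records, in the
kernel, the quantifier fork this opens — the analogue, one level up (inputs instead of packets), of XXIV's local/global fork:

* `soundAtThetaPilot_iff_statement` — AT THE INPUT OF THE LINK (`o := P.thetaPilot`, whose gluing image is the q-pilot,
  Step (xi-a)) the soundness clause IS the printed Statement, definitionally (A1's `negLogThetaAt_thetaPilot`,
  `negLogQAt_qPilot`, `G.link_thetaPilot`). So the Θ-pilot instance of `SoundAtInput` = `Cor312.Setting.Statement` =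
  skel XXV's `InputStrip.StripAlgorithm.GapGlobal` (`gapGlobal_iff_statement`, XXVb).
* `InputPowers.fork` — AT OTHER INPUTS the clause is extra content: a verbatim setting (two objects of `†𝒞^⊩_lgp`: the
  Θ-pilot and one more) satisfying all of abc-iut-c312-6's `BridgeHyps`, "`|log(q)| > 0`" and the printed Statement,
  in which `SoundAtInput` FAILS for the identity gluing — at the second object, whose possible images have hull-volume
  `−3` while its gluing image has `q`-side volume `−1`. So `SoundAtInput` (∀ o) is STRICTLY STRONGER than the
  Corollary at the level of the frozen definitions.

WHY THE EXTRA INSTANCES ARE NOT THE PRINT'S (and are expected FALSE in the intended model). In the intended model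
`†𝒞^⊩_lgp` contains the tensor powers `(Θ-pilot)^{⊗N}`; their Kummer images and gluing images are the `N`-th powers of
the pilots' (volumes scale by `N`, the indeterminacy/hull inflation does not), so `SoundAtInput` at `o = Θ^{⊗N}` is the
"`N`-th power analogue" of Cor. 3.12 — which the print DISOWNS, [IUTchIII] Step (xi-h), kurims `paper:url-4b091feeb646`
p. 185 l. 48–58, verbatim: "the above argument depends, in an essential way [cf. the discussion of (ii), (vi)], on the
theory of [EtTh], which does not admit any evident generalization to the case of `N`-th tensor powers of Θ-pilot
objects, for `N ≥ 2`. That is to say, the log-volume of such an `N`-th tensor power of a Θ-pilot object must always be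
computed as the result of multiplying the log-volume of the original Θ-pilot object by `N` … In particular, although the
analogue of the above argument for such an `N`-th tensor power would lead to sharper inequalities than the inequalities
obtained here, it is difficult to see how to obtain such sharper inequalities via a routine generalization of the above
argument. In fact, as we shall see in [IUTchIV], these sharper inequalities are known to be false [cf. [IUTchIV],
Remark 2.3.2, (ii)]." Hence — as with the per-packet readings (XXIV) and with skel's own `Sound₁` over a permissive
`Realized₁` (XXV/XXVb) — a gap decl that quantifies BEYOND the link's actual input is either an instance where
soundness is idle or an instance the print declares false; at the frozen level the gap of record is the Θ-pilot
instance, i.e. the Corollary's inequality ("non-circular" is available only at M-level, by typing the algorithm).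
[claim: Mochizuki2012, status: disputed] Deliberately NOT here: any claim about the intended instantiation (the
`N`-th power computation is [IUTchIV] Rmk. 2.3.2 (ii) / campaign S); any judgement on (xi-f).
-/

noncomputable section

namespace Summit.ABC

namespace IUTFork

namespace Cor312Vol

open Thm311 Cor312 Literature.IUT.LogThetaLattice

variable {T : ThetaIndex} {S : Situation T} (P : Cor312.Setting S)

/-! ## 1. At the input of the link the soundness clause IS the Statement -/

/-- **The Θ-pilot instance of `SoundAtInput` is the printed Statement**, definitionally: the gluing image of the
Θ-pilot is the q-pilot ((xi-a), `G.link_thetaPilot`), and the input-parameterized volumes specialize to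
`−|log(Θ)|`, `−|log(q)|`. [claim: Mochizuki2012, status: disputed] -/
theorem soundAtThetaPilot_iff_statement (G : LinkGluing P) :
    (negLogThetaAt P P.thetaPilot ≠ ⊤ ∧
        ((negLogQAt P (G.linkMap P.thetaPilot) : ℝ) : WithTop ℝ) ≤ negLogThetaAt P P.thetaPilot) ↔
      P.Statement := by
  rw [G.link_thetaPilot, negLogThetaAt_thetaPilot, negLogQAt_qPilot]
  rfl

/-- Hence `SoundAtInput` = the Statement ∧ soundness at every OTHER input object. [folklore] -/
theorem soundAtInput_iff (G : LinkGluing P) :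
    SoundAtInput P G ↔ P.Statement ∧ ∀ o : P.Ob P.sig.Clgp, o ≠ P.thetaPilot →
      negLogThetaAt P o ≠ ⊤ ∧ ((negLogQAt P (G.linkMap o) : ℝ) : WithTop ℝ) ≤ negLogThetaAt P o := by
  constructor
  · intro h
    exact ⟨(soundAtThetaPilot_iff_statement P G).mp (h P.thetaPilot), fun o _ => h o⟩
  · rintro ⟨hs, ho⟩ o
    by_cases hoo : o = P.thetaPilot
    · subst hoo; exact (soundAtThetaPilot_iff_statement P G).mpr hs
    · exact ho o hoo

/-! ## 2. The witness: two input objects, Statement and all bridge hypotheses hold, `SoundAtInput` fails -/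

namespace InputPowers

open Cor312.Checks LocalGlobal

/-- A Prop. 3.7 output signature with TWO objects in every Frobenioid (`Bool`; the object-forming algorithms
produce `true` = the pilot) over one-point Frobenioids/strips/monoids. [folklore] -/
def twoSig : GlobalLGPFrobenioidSignature 2 Unit (· ∈ (Set.univ : Set Unit)) Unit (fun _ _ => Unit)
    (fun _ => Bool) id Unit (fun _ _ => Unit) (fun _ _ => Unit) where
  FMOD := fun _ => ()
  Fmod := fun _ => ()
  Ffrak := fun _ => ()
  isoModMOD := fun _ => ()
  isoModFrak := fun _ => ()
  isoFrakMOD := fun _ => ()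
  CLGP := ()
  Clgp := ()
  FLGP := ()
  Flgp := ()
  Fgau := ()
  isoGauLGP := ()
  isoLGPlgp := ()
  isoCLGPlgp := ()
  embLGP := fun b _ => b
  embLgp := fun b _ => b
  embLGP_injective := fun a b h => by simpa using congrFun h ⟨0, by decide⟩
  embLgp_injective := fun a b h => by simpa using congrFun h ⟨0, by decide⟩
  objOfLgp := fun _ => true
  objOfLGP := fun _ => true
  objOfFrak := fun _ _ => true
  objOfMOD := fun _ _ => true

/-- The WITNESS SETTING over XXIVb's `lgSituation` (`l⋇ = 2`, one place, log-volume `−3` inside `{0}` / `−1` outside,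
hull frame `lgFrame`): two objects in `†𝒞^⊩_lgp` and in `†𝒞^⊩_△` (`Bool`, pilots = `true`); Kummer images of the
pilot `true` = everything, of the second object `false` = `{0}`; every `q`-side image = everything. [folklore] -/
def powSetting : Setting lgSituation where
  n := 0
  HT := ℤ × ℤ
  LogLink := fun _ _ => Unit
  IsFull := fun _ => True
  lattice :=
    { theater := fun n m => (n, m)
      distinct := fun p q h => by simpa using h
      logLink := fun _ _ => ()
      logLink_full := fun _ _ => trivial }
  Frd := Unit
  IsoF := fun _ _ => Unit
  Ob := fun _ => Bool
  realify := id
  Strip := Unit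
  IsoS := fun _ _ => Unit
  M := fun _ _ => Unit
  sig := twoSig
  split := { Msplit := fun _ _ => ⊤, exists_gen := fun _ _ => ⟨⟨(), trivial⟩, top_unit_isGenerator _⟩ }
  ObΔ := Bool
  N := fun _ _ => Unit
  qData := { q := fun _ _ => (), q_gen := fun _ _ => unit_isGenerator _, objOf := fun _ => true }
  frame := fun _ _ => lgFrame _
  hul_adm := fun _ _ _ _ => trivial
  thetaRegionOf := fun _ o _ _ => if o then Set.univ else {0}
  qRegionOf := fun _ _ _ => Set.univ
  qRegion_mem := fun _ _ => Set.univ_nonempty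
  qSupport_finite := fun _ => Set.toFinite _

/-- The Θ-pilot of the witness is the object `true`. [folklore] -/
theorem pow_thetaPilot : powSetting.thetaPilot = true := rfl

/-- The identity value-group gluing of the witness (objects of `†𝒞^⊩_lgp` and of `†𝒞^⊩_△` are both `Bool`; the
pilot `true` goes to the pilot `true`). [folklore] -/
def powGluing : LinkGluing powSetting where
  linkMap := fun o => o
  link_thetaPilot := rfl

/-- The q-pilot of the witness is the object `true`. [folklore] -/
theorem pow_qPilot : powSetting.qPilot = true := rfl

/-- The (Ind3)-enlarged Kummer image of the object `o`. [folklore] -/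
theorem pow_thetaRegion3At (o : Bool) (j : toyIndex.Label) (vQ : toyIndex.VQ) :
    thetaRegion3At powSetting o j vQ = if o then Set.univ else {0} :=
  Set.iUnion_const _

/-- Every possible image of `o` is its (Ind3)-enlarged image (`univ`, `{0}` are fixed by linear automorphisms).
[folklore] -/
theorem pow_eq_of_mem_possibleImagesAt {o : Bool} {j : toyIndex.Label} {vQ : toyIndex.VQ}
    {U : Set (lgSituation.L.Packet j vQ)} (hU : U ∈ possibleImagesAt powSetting o j vQ) :
    U = thetaRegion3At powSetting o j vQ := by
  obtain ⟨Φ, -, rfl⟩ := hU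
  rw [pow_thetaRegion3At]
  split_ifs
  · exact Set.image_univ_of_surjective (Φ j vQ).surjective
  · rw [Set.image_singleton, map_zero]

/-- The (Ind3)-enlarged image is a possible image (identity indeterminacy). [folklore] -/
theorem pow_thetaRegion3At_mem (o : Bool) (j : toyIndex.Label) (vQ : toyIndex.VQ) :
    thetaRegion3At powSetting o j vQ ∈ possibleImagesAt powSetting o j vQ :=
  ⟨1, (Setting.indGroup lgSituation).one_mem, by simp⟩

/-- Hence the union of the possible images of `o` is that image, nonempty … [folklore] -/
theorem pow_sUnion_possibleImagesAt (o : Bool) (j : toyIndex.Label) (vQ : toyIndex.VQ) :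
    ⋃₀ possibleImagesAt powSetting o j vQ = thetaRegion3At powSetting o j vQ :=
  Set.Subset.antisymm (Set.sUnion_subset fun _ hU => (pow_eq_of_mem_possibleImagesAt hU).le)
    (Set.subset_sUnion_of_mem (pow_thetaRegion3At_mem o j vQ))

/-- … nonempty … [folklore] -/
theorem pow_thetaRegion3At_nonempty (o : Bool) (j : toyIndex.Label) (vQ : toyIndex.VQ) :
    (thetaRegion3At powSetting o j vQ).Nonempty := by
  rw [pow_thetaRegion3At]
  split_ifs
  · exact Set.univ_nonempty
  · exact Set.singleton_nonempty 0

/-- … and the local hull volume of `o` is `−1` for the pilot, `−3` for the second object. [folklore] -/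
theorem pow_thetaLocalAt (o : Bool) (j : toyIndex.Label) (vQ : toyIndex.VQ) :
    thetaLocalAt powSetting o j vQ = ((if o then (-1 : ℝ) else -3 : ℝ) : WithTop ℝ) := by
  have hdef : HullDefinedAt powSetting o j vQ :=
    ⟨trivial, by
      show (⋃₀ possibleImagesAt powSetting o j vQ).Nonempty
      rw [pow_sUnion_possibleImagesAt]; exact pow_thetaRegion3At_nonempty o j vQ⟩
  unfold thetaLocalAt
  rw [if_pos hdef]
  unfold thetaHullAt
  rw [pow_sUnion_possibleImagesAt, show (powSetting.frame j vQ).hull (thetaRegion3At powSetting o j vQ) =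
    thetaRegion3At powSetting o j vQ from lgFrame_hull (pow_thetaRegion3At_nonempty o j vQ), pow_thetaRegion3At]
  show ((lgVol j vQ (if o then Set.univ else {0}) : ℝ) : WithTop ℝ) = _
  split_ifs
  · rw [lgVol_univ]
  · rw [lgVol_of_subset Set.Subset.rfl]

/-- Every input of the witness has finite `−|log(Θ)|`. [folklore] -/
theorem pow_thetaFiniteAt (o : Bool) : ThetaFiniteAt powSetting o :=
  ⟨fun i vQ => by rw [pow_thetaLocalAt]; exact WithTop.coe_ne_top, fun _ => Set.toFinite _⟩

/-- The global hull volume of the input `o`: `−1` for the pilot, `−3` for the second object. [folklore] -/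
theorem pow_negLogThetaAt (o : Bool) : negLogThetaAt powSetting o = ((if o then (-1 : ℝ) else -3 : ℝ) : WithTop ℝ) := by
  unfold negLogThetaAt
  rw [if_pos (pow_thetaFiniteAt o)]
  congr 1
  simp only [pow_thetaLocalAt, WithTop.untopD_coe, finsum_unique]
  exact processionNormalized_const (by decide) _

/-- The global `q`-side volume of every object of `†𝒞^⊩_△` of the witness is `−1`. [folklore] -/
theorem pow_negLogQAt (o' : Bool) : negLogQAt powSetting o' = -1 := by
  unfold negLogQAt qLocalAt
  have h : ∀ (i : Fin toyIndex.lstar) (vQ : toyIndex.VQ),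
      (lgSituation.D powSetting.n).logvol (Setting.labelSucc i) vQ (powSetting.qRegionOf o' (Setting.labelSucc i) vQ) = -1 :=
    fun i vQ => lgVol_univ _ vQ
  simp only [h, finsum_unique]
  exact processionNormalized_const (by decide) _

/-- `−|log(Θ)| = −1` in the witness. [folklore] -/
theorem pow_negLogTheta : powSetting.negLogTheta = ((-1 : ℝ) : WithTop ℝ) := by
  rw [← negLogThetaAt_thetaPilot powSetting, pow_thetaPilot, pow_negLogThetaAt, if_pos rfl]

/-- `−|log(q)| = −1` in the witness. [folklore] -/
theorem pow_negLogQ : powSetting.negLogQ = -1 := by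
  rw [← negLogQAt_qPilot powSetting, pow_qPilot, pow_negLogQAt]

/-- The printed Statement HOLDS in the witness (`−1 ≤ −1`). [folklore] -/
theorem pow_statement : powSetting.Statement := by
  refine ⟨by rw [pow_negLogTheta]; exact WithTop.coe_ne_top, ?_⟩
  rw [pow_negLogTheta, pow_negLogQ]

/-- "`|log(q)| > 0`" holds in the witness. [folklore] -/
theorem pow_absLogQPos : powSetting.AbsLogQPos := by
  show powSetting.negLogQ < 0
  rw [pow_negLogQ]; norm_num

/-- All of c312-6's bridge hypotheses hold in the witness. [folklore] -/
theorem pow_bridgeHyps : BridgeHyps powSetting where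
  mono := fun _ _ _ _ _ _ hAB => lgVol_mono hAB
  image_adm := fun _ _ _ _ => trivial
  image_fin := fun _ => Set.toFinite _
  hul_nonempty := fun _ _ _ hH => hH
  theta_nonempty := fun i vQ =>
    show (thetaRegion3At powSetting powSetting.thetaPilot (Setting.labelSucc i) vQ).Nonempty from
      pow_thetaRegion3At_nonempty _ _ vQ
  finite := show ThetaFiniteAt powSetting powSetting.thetaPilot from pow_thetaFiniteAt _

/-- **`SoundAtInput` FAILS in the witness** for the identity gluing: at the second input object the `q`-side volume
`−1` exceeds the hull volume `−3`. [folklore] -/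
theorem pow_not_soundAtInput : ¬ SoundAtInput powSetting powGluing := by
  intro h
  have h2 := (h false).2
  rw [pow_negLogThetaAt, show powGluing.linkMap false = false from rfl, pow_negLogQAt, WithTop.coe_le_coe] at h2
  norm_num at h2

/-- **THE INPUT-QUANTIFIER FORK, kernel form.** A verbatim `Cor312.Setting` with all bridge hypotheses,
"`|log(q)| > 0`" and the printed Statement, and a link gluing, for which `SoundAtInput` (soundness at EVERY input
object) FAILS — so `SoundAtInput` is strictly stronger than the Corollary at the frozen level; its extra instances are
the ones [IUTchIII] Step (xi-h) declares false in the intended model (`N`-th tensor powers).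
[claim: Mochizuki2012, status: disputed] -/
theorem fork :
    ∃ (_ : BridgeHyps powSetting) (G : LinkGluing powSetting),
      powSetting.AbsLogQPos ∧ powSetting.Statement ∧ ¬ SoundAtInput powSetting G :=
  ⟨pow_bridgeHyps, powGluing, pow_absLogQPos, pow_statement, pow_not_soundAtInput⟩

end InputPowers

end Cor312Vol

end IUTFork

end Summit.ABC

end
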